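import Summits.QuantumFields.QCD.Theorems.SpectralDefectExtinctionChiralDescentStubGapUpsetNoStartOfCornerPin
import Summits.QuantumFields.QCD.Theses.SpectralDefectExtinction

/-!
# Crux `SpectralDefectExtinction.ChiralDescent` (stmt-QuantumFields-17527), line `gap-upset-recut` — the CORNER-FREE residual
# `RaySoftPoint`: Q2 ⇐ RaySoftPoint, and the crux BY NAME ⇐ W ∧ RaySoftPoint ∧ `EulerDescent.RetypedContinuumComplement` (16903)
# (lead a1, cycle 1; `--supports`)

`Theorems/…StubGapUpsetNoStartOfCornerPin.lean` (p150634) and `…OfEulerDescentCornerPin.lean` (p150961) reduce Q2 and the crux to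
route EulerDescent's items plus `CornerPin`, which is typed through EulerDescent's INTRINSIC corner (the IsLUB of the non-massive
degenerate bare masses at `β_k`) — a notion that mis-pins in the Sharpe–Singleton first-order scenario.  This file removes the corner:
all the composition ever uses of `16900 ∧ 16902 ∧ CornerPin` is their joint CONSEQUENCE for the given regularisation, namely a

  RAY-SOFT POINT `ν₀ ∈ ℝ` of `reg`:  (ray)  for every positive tuple `m`, `l ≥ 1`, `Δ > 0`, the lattice rate `Δ` at the tuple
  `ν₀ + l·m` gives every rate `Δ' < Δ/l` at `ν₀ + m`  (Euler / Feynman–Hellmann descent of the gap along rays from `ν₀·𝟙`), and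
  (soft) for every `ε > 0` some positive `m` has NO rate `ε` at `ν₀ + m`  (the lattice gap closes at `ν₀·𝟙`: `ν₀` is the chiral point).

* `stub_gapUpsetNoStart_of_raySoftPoint`: Q2 (verbatim the registered stub) ⇐ "every interior mass-scaling regularisation carrying the
  body above some offset has a ray-soft point" (`RaySoftPoint`, the hypothesis `hRS`).  Case `ν₀ ≥ μ` is empty by (soft); case `ν₀ < μ`
  descends the rate from `μ` to `(ν₀ + μ)/2` by (ray) (`rate_descend_of_rayProperty`, p150634).
* `qcdOf_of_raySoftPoint_of_continuumComplement`: for ONE interior mass-scaling `reg` with the body above `M₁` and a ray-soft point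
  `ν₀`, item 16903 gives `QCDOf N_f` with the witness `reg` re-zeroed at `ν₀` — lattice gaps at every positive tuple by (ray) from the
  heavy body, the full body by 16903, chirality by (soft).
* `chiralDescent_of_wallNoGo_of_raySoftPoint_of_continuumComplement`: the crux BY NAME ⇐ W ∧ RaySoftPoint ∧ 16903.
* `raySoftPoint_of_cornerPin`: 16900 ∧ 16902 ∧ (corner `mc`, convergent offset `μ₀`) give the ray-soft point `ν₀ = −μ₀` — so this
  file GENERALISES p150634 / p150961.

Upshot for the planner: the corner-free residual of the crux is the pair (W_lim, RaySoftPoint) on top of the construction item 16903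
(or its local form Q3 / item 18327 via the up-set composition).  `RaySoftPoint` is the typed `LocateChiralPoint ∧ GoldstoneClosure` of
the route's TWO-LAYER PLAN in its weakest usable form (a located offset with Euler descent towards it and gap closure at it); it is
conjecture class (Feynman–Hellmann sigma-share bound + Goldstone / anomaly matching), nothing here proves it.  Pure bookkeeping; std axioms.
-/

namespace Summit.QuantumFields.QCD.Cruxes.ChiralDescent.GapUpsetRecut

open Filter Topology
open Literature.MathematicalPhysics.QuantumFieldTheory
open Summit.QuantumFields.QCD.Theorems.RobustYangMillsHandover.Negative (tendsto_massIncrement_zero)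

variable {Nf : ℕ}

/-- Re-zeroing at an offset `ν₀`, scheme level: the regularisation with `m_crit + a ν₀/Z_m` runs at `m` the scheme of `reg` at
`ν₀ + m`. [folklore] -/
theorem offsetShift_scheme_eq (reg : QCDRegularisation Nf) (ν₀ : ℝ) (m : Fin Nf → ℝ) (z shift : QCDField Nf → ℕ → ℝ) :
    ({ reg with mcrit := fun k => reg.mcrit k + reg.a k * ν₀ / reg.Zm k } : QCDRegularisation Nf).scheme m z shift
      = reg.scheme (fun f => ν₀ + m f) z shift := by
  simp only [QCDRegularisation.scheme, QCDScheme.mk.injEq, true_and, and_true]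
  funext f k
  ring

/-- **Q2 ⇐ RaySoftPoint.**  For `N_f ∈ {2,3}`, an interior mass-scaling regularisation with the body above `μ` and ONE lattice rate
above `μ`: IF every such regularisation has a ray-soft point `ν₀` (hypothesis `hRS`: Euler descent of lattice rates along rays from
`ν₀·𝟙`, and gap closure at `ν₀·𝟙`), THEN one lattice rate holds above some `μ' < μ` — VERBATIM the registered stub
`stub_gapUpsetNoStart`.  Case `μ ≤ ν₀`: the rate above `μ` is a rate at every `ν₀ + m`, `m` positive, against (soft) — empty case.
Case `ν₀ < μ`: (ray) descends the rate from `μ` to `(ν₀ + μ)/2`. [folklore] -/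
theorem stub_gapUpsetNoStart_of_raySoftPoint :
    ∀ (hRS : ∀ Nf : ℕ, (Nf = 2 ∨ Nf = 3) → ∀ reg : QCDRegularisation Nf, reg.HasMassScaling →
      (∃ c : ℝ, -1 < c ∧ ∀ᶠ k in atTop, c ≤ reg.mcrit k) → ∀ μ : ℝ,
      (∀ m : Fin Nf → ℝ, (∀ f, μ < m f) →
        ∃ (z shift : QCDField Nf → ℕ → ℝ) (T : OSData (QCDField Nf) 4),
          IsQCDAlong (reg.scheme m z shift) T ∧ T.IsNontrivial QCDField.glue ∧ T.IsNonGaussian QCDField.glue ∧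
            (∀ f g : Fin Nf, f ≠ g → T.IsNontrivial (QCDField.pseudoRe f g)) ∧
              ∃ Δ > 0, T.HasMassGap Δ ∧ (reg.scheme m z shift).HasLatticeMassGap Δ) →
      ∃ ν₀ : ℝ,
        (∀ m : Fin Nf → ℝ, (∀ f, 0 < m f) → ∀ l : ℝ, 1 ≤ l → ∀ Δ : ℝ, 0 < Δ →
          (reg.scheme (fun f => ν₀ + l * m f) 0 0).HasLatticeMassGap Δ → ∀ Δ' : ℝ, 0 < Δ' → Δ' < Δ / l →
            (reg.scheme (fun f => ν₀ + m f) 0 0).HasLatticeMassGap Δ') ∧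
        (∀ ε > (0 : ℝ), ∃ m : Fin Nf → ℝ, (∀ f, 0 < m f) ∧ ¬ (reg.scheme (fun f => ν₀ + m f) 0 0).HasLatticeMassGap ε)),
    ∀ Nf : ℕ, (Nf = 2 ∨ Nf = 3) → ∀ reg : QCDRegularisation Nf, reg.HasMassScaling →
    (∃ c : ℝ, -1 < c ∧ ∀ᶠ k in atTop, c ≤ reg.mcrit k) → ∀ μ : ℝ,
    (∀ m : Fin Nf → ℝ, (∀ f, μ < m f) →
      ∃ (z shift : QCDField Nf → ℕ → ℝ) (T : OSData (QCDField Nf) 4),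
        IsQCDAlong (reg.scheme m z shift) T ∧ T.IsNontrivial QCDField.glue ∧ T.IsNonGaussian QCDField.glue ∧
          (∀ f g : Fin Nf, f ≠ g → T.IsNontrivial (QCDField.pseudoRe f g)) ∧
            ∃ Δ > 0, T.HasMassGap Δ ∧ (reg.scheme m z shift).HasLatticeMassGap Δ) →
    (∃ ε > (0 : ℝ), ∀ m : Fin Nf → ℝ, (∀ f, μ < m f) → (reg.scheme m 0 0).HasLatticeMassGap ε) →
    ∃ μ' : ℝ, μ' < μ ∧ ∃ ε > (0 : ℝ), ∀ m : Fin Nf → ℝ, (∀ f, μ' < m f) → (reg.scheme m 0 0).HasLatticeMassGap ε := by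
  intro hRS Nf hNf reg hMS hint μ hbody hG
  obtain ⟨ν₀, hray, hsoft⟩ := hRS Nf hNf reg hMS hint μ hbody
  obtain ⟨ε, hε, hgap⟩ := hG
  by_cases hcase : μ ≤ ν₀
  · exfalso
    obtain ⟨m, hm, hno⟩ := hsoft ε hε
    exact hno (hgap _ fun f => by have := hm f; linarith)
  · push Not at hcase
    have hG₀ : ∃ ε > (0 : ℝ), ∀ m : Fin Nf → ℝ, (∀ f, μ - ν₀ < m f) →
        (reg.scheme (fun f => ν₀ + m f) 0 0).HasLatticeMassGap ε :=
      ⟨ε, hε, fun m hm => hgap _ fun f => by have := hm f; linarith⟩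
    have hhalf : (0 : ℝ) < (μ - ν₀) / 2 := by linarith
    have hlt : (μ - ν₀) / 2 < μ - ν₀ := by linarith
    obtain ⟨ε', hε', hgap'⟩ := rate_descend_of_rayProperty
      (fun m Δ => (reg.scheme (fun f => ν₀ + m f) 0 0).HasLatticeMassGap Δ) hray hhalf hlt hG₀
    refine ⟨(ν₀ + μ) / 2, by linarith, ε', hε', fun m hm => ?_⟩
    have heq : m = fun f => ν₀ + (m f - ν₀) := funext fun f => by ring
    rw [heq]
    exact hgap' _ fun f => by have := hm f; linarith

/-- **`QCDOf N_f` from ONE interior mass-scaling regularisation with the body above `M₁`, a ray-soft point `ν₀`, and item 16903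
`EulerDescent.RetypedContinuumComplement`.**  Witness: `reg` re-zeroed at `ν₀` (`m_crit + a ν₀/Z_m`; its scheme at `m` is
`reg.scheme (ν₀ + m)`).  It keeps mass scaling, reads asymptotic scaling off one body tuple, is eventually on the physical branch
(interiority + `a ν₀/Z_m → 0`), carries the heavy body above `max (M₁ − ν₀) 0 + 1`, has a lattice gap at EVERY positive tuple by
(ray) from the heavy body (`l := 1 + Σ_f M_h/m_f`), hence the full body everywhere by 16903, and is chiral at zero by (soft).
[folklore] -/
theorem qcdOf_of_raySoftPoint_of_continuumComplement (h16903 : Theses.EulerDescent.RetypedContinuumComplement)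
    (hNf : Nf = 2 ∨ Nf = 3) (reg : QCDRegularisation Nf) (hMS : reg.HasMassScaling)
    (hint : ∃ c : ℝ, -1 < c ∧ ∀ᶠ k in atTop, c ≤ reg.mcrit k) {M₁ : ℝ}
    (hbody : ∀ m : Fin Nf → ℝ, (∀ f, M₁ < m f) →
      ∃ (z shift : QCDField Nf → ℕ → ℝ) (T : OSData (QCDField Nf) 4),
        IsQCDAlong (reg.scheme m z shift) T ∧ T.IsNontrivial QCDField.glue ∧ T.IsNonGaussian QCDField.glue ∧
          (∀ f g : Fin Nf, f ≠ g → T.IsNontrivial (QCDField.pseudoRe f g)) ∧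
            ∃ Δ > 0, T.HasMassGap Δ ∧ (reg.scheme m z shift).HasLatticeMassGap Δ)
    {ν₀ : ℝ}
    (hray : ∀ m : Fin Nf → ℝ, (∀ f, 0 < m f) → ∀ l : ℝ, 1 ≤ l → ∀ Δ : ℝ, 0 < Δ →
      (reg.scheme (fun f => ν₀ + l * m f) 0 0).HasLatticeMassGap Δ → ∀ Δ' : ℝ, 0 < Δ' → Δ' < Δ / l →
        (reg.scheme (fun f => ν₀ + m f) 0 0).HasLatticeMassGap Δ')
    (hsoft : ∀ ε > (0 : ℝ), ∃ m : Fin Nf → ℝ, (∀ f, 0 < m f) ∧ ¬ (reg.scheme (fun f => ν₀ + m f) 0 0).HasLatticeMassGap ε) :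
    QCDOf Nf := by
  have hNf16 : Nf ≤ 16 := by rcases hNf with rfl | rfl <;> norm_num
  set reg₀ : QCDRegularisation Nf := { reg with mcrit := fun k => reg.mcrit k + reg.a k * ν₀ / reg.Zm k } with hreg₀
  have hs : ∀ (m : Fin Nf → ℝ) (z shift : QCDField Nf → ℕ → ℝ),
      reg₀.scheme m z shift = reg.scheme (fun f => ν₀ + m f) z shift :=
    fun m z shift => offsetShift_scheme_eq reg ν₀ m z shift
  have hMS₀ : reg₀.HasMassScaling := hMS
  obtain ⟨z₁, s₁, T₁, hQ₁, -⟩ := hbody (fun _ => M₁ + 1) (fun _ => by linarith)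
  have hAS₀ : (reg₀.scheme 0 0 0).HasAsymptoticScaling := by
    obtain ⟨hAS, -⟩ := hQ₁
    exact hAS
  have hbranch₀ : ∀ᶠ k in atTop, (-1 : ℝ) < reg₀.mcrit k := by
    obtain ⟨c, hc, hev⟩ := hint
    have h0 := tendsto_massIncrement_zero hNf16 reg hMS ν₀
    have hneg : -((c + 1) / 2) < (0 : ℝ) := by linarith
    filter_upwards [hev, (tendsto_order.mp h0).1 (-((c + 1) / 2)) hneg] with k hk hk'
    change (-1 : ℝ) < reg.mcrit k + reg.a k * ν₀ / reg.Zm k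
    linarith
  -- heavy body of reg₀
  set Mh : ℝ := max (M₁ - ν₀) 0 + 1 with hMh_def
  have hMh : 0 < Mh := by rw [hMh_def]; positivity
  have hheavy : ∀ m : Fin Nf → ℝ, (∀ f, Mh ≤ m f) →
      ∃ (z shift : QCDField Nf → ℕ → ℝ) (T : OSData (QCDField Nf) 4),
        IsQCDAlong (reg₀.scheme m z shift) T ∧ T.IsNontrivial QCDField.glue ∧ T.IsNonGaussian QCDField.glue ∧
          (∀ f g : Fin Nf, f ≠ g → T.IsNontrivial (QCDField.pseudoRe f g)) ∧
            ∃ Δ > 0, T.HasMassGap Δ ∧ (reg₀.scheme m z shift).HasLatticeMassGap Δ := by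
    intro m hm
    obtain ⟨z, s, T, hT⟩ := hbody (fun f => ν₀ + m f) (fun f => by
      have h1 := hm f
      have h2 : M₁ - ν₀ ≤ max (M₁ - ν₀) 0 := le_max_left _ _
      rw [hMh_def] at h1
      linarith)
    exact ⟨z, s, T, by rw [hs]; exact hT⟩
  -- lattice gaps at every positive tuple of reg₀, by ray descent from the heavy body
  have hgap : ∀ m : Fin Nf → ℝ, (∀ f, 0 < m f) → ∃ Δ > 0, (reg₀.scheme m 0 0).HasLatticeMassGap Δ := by
    intro m hm
    set l : ℝ := 1 + ∑ f, Mh / m f with hl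
    have hterm : ∀ f, 0 ≤ Mh / m f := fun f => div_nonneg hMh.le (hm f).le
    have hsum : 0 ≤ ∑ f, Mh / m f := Finset.sum_nonneg fun f _ => hterm f
    have hl1 : 1 ≤ l := by rw [hl]; linarith
    have hlpos : 0 < l := lt_of_lt_of_le one_pos hl1
    have hlm : ∀ f, Mh ≤ l * m f := by
      intro f
      have h1 : Mh / m f ≤ ∑ g, Mh / m g := Finset.single_le_sum (fun g _ => hterm g) (Finset.mem_univ f)
      have h2 : Mh / m f ≤ l := by rw [hl]; linarith
      calc Mh = Mh / m f * m f := by rw [div_mul_cancel₀ _ (hm f).ne']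
        _ ≤ l * m f := mul_le_mul_of_nonneg_right h2 (hm f).le
    obtain ⟨z, shift, T, -, -, -, -, Δ, hΔ, -, hlat⟩ := hheavy (fun f => l * m f) hlm
    have hlat0 : (reg.scheme (fun f => ν₀ + l * m f) 0 0).HasLatticeMassGap Δ := by
      have h := hlat
      rw [hs] at h
      exact h
    refine ⟨Δ / l / 2, by positivity, ?_⟩
    have hlt : Δ / l / 2 < Δ / l := by
      have : 0 < Δ / l := by positivity
      linarith
    rw [hs]
    exact hray m hm l hl1 Δ hΔ hlat0 (Δ / l / 2) (by positivity) hlt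
  have hchi : reg₀.IsChiralAtZero := by
    intro ε hε
    obtain ⟨m, hm, hno⟩ := hsoft ε hε
    exact ⟨m, hm, by rw [hs]; exact hno⟩
  have hfull := h16903 Nf hNf reg₀ hMS₀ hAS₀ hbranch₀ ⟨Mh, hMh, hheavy⟩ hgap
  exact ⟨reg₀, hMS₀, hchi, hfull⟩

/-- **The crux BY NAME ⇐ W ∧ RaySoftPoint ∧ 16903** (corner-free form of `chiralDescent_of_eulerDescent_of_wallNoGo_of_cornerPin`,
p150961): the threshold regularisation is at the wall (W: contradiction) or interior, where `RaySoftPoint` locates `ν₀` and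
`qcdOf_of_raySoftPoint_of_continuumComplement` concludes. Q1, Q2, Q3, item 18328 and EulerDescent's corner are not used. [folklore] -/
theorem chiralDescent_of_wallNoGo_of_raySoftPoint_of_continuumComplement :
    ∀ (h16903 : Theses.EulerDescent.RetypedContinuumComplement)
    (hW : ∀ Nf : ℕ, (Nf = 2 ∨ Nf = 3) → ∀ reg : QCDRegularisation Nf, reg.HasMassScaling →
      (∀ c : ℝ, -1 < c → ∃ᶠ k in atTop, reg.mcrit k < c) → ∀ μ : ℝ,
      ¬ ∀ m : Fin Nf → ℝ, (∀ f, μ < m f) →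
        ∃ (z shift : QCDField Nf → ℕ → ℝ) (T : OSData (QCDField Nf) 4),
          IsQCDAlong (reg.scheme m z shift) T ∧ T.IsNontrivial QCDField.glue ∧ T.IsNonGaussian QCDField.glue ∧
            (∀ f g : Fin Nf, f ≠ g → T.IsNontrivial (QCDField.pseudoRe f g)) ∧
              ∃ Δ > 0, T.HasMassGap Δ ∧ (reg.scheme m z shift).HasLatticeMassGap Δ)
    (hRS : ∀ Nf : ℕ, (Nf = 2 ∨ Nf = 3) → ∀ reg : QCDRegularisation Nf, reg.HasMassScaling →
      (∃ c : ℝ, -1 < c ∧ ∀ᶠ k in atTop, c ≤ reg.mcrit k) → ∀ μ : ℝ,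
      (∀ m : Fin Nf → ℝ, (∀ f, μ < m f) →
        ∃ (z shift : QCDField Nf → ℕ → ℝ) (T : OSData (QCDField Nf) 4),
          IsQCDAlong (reg.scheme m z shift) T ∧ T.IsNontrivial QCDField.glue ∧ T.IsNonGaussian QCDField.glue ∧
            (∀ f g : Fin Nf, f ≠ g → T.IsNontrivial (QCDField.pseudoRe f g)) ∧
              ∃ Δ > 0, T.HasMassGap Δ ∧ (reg.scheme m z shift).HasLatticeMassGap Δ) →
      ∃ ν₀ : ℝ,
        (∀ m : Fin Nf → ℝ, (∀ f, 0 < m f) → ∀ l : ℝ, 1 ≤ l → ∀ Δ : ℝ, 0 < Δ →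
          (reg.scheme (fun f => ν₀ + l * m f) 0 0).HasLatticeMassGap Δ → ∀ Δ' : ℝ, 0 < Δ' → Δ' < Δ / l →
            (reg.scheme (fun f => ν₀ + m f) 0 0).HasLatticeMassGap Δ') ∧
        (∀ ε > (0 : ℝ), ∃ m : Fin Nf → ℝ, (∀ f, 0 < m f) ∧ ¬ (reg.scheme (fun f => ν₀ + m f) 0 0).HasLatticeMassGap ε)),
    Summit.QuantumFields.QCD.Theses.SpectralDefectExtinction.ChiralDescent := by
  intro h16903 hW hRS
  unfold Summit.QuantumFields.QCD.Theses.SpectralDefectExtinction.ChiralDescent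
  rintro Nf hNf ⟨reg, hMS, M₁, -, hbody⟩
  by_cases hint : ∃ c : ℝ, -1 < c ∧ ∀ᶠ k in atTop, c ≤ reg.mcrit k
  · obtain ⟨ν₀, hray, hsoft⟩ := hRS Nf hNf reg hMS hint M₁ hbody
    exact qcdOf_of_raySoftPoint_of_continuumComplement h16903 hNf reg hMS hint hbody hray hsoft
  · exfalso
    have hwall : ∀ c : ℝ, -1 < c → ∃ᶠ k in atTop, reg.mcrit k < c := by
      intro c hc
      have hnev : ¬ ∀ᶠ k in atTop, c ≤ reg.mcrit k := fun hev => hint ⟨c, hc, hev⟩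
      simpa only [Filter.not_eventually, not_le] using hnev
    exact hW Nf hNf reg hMS hwall M₁ hbody

/-- **RaySoftPoint ⇐ 16900 ∧ 16902 ∧ (corner, convergent offset)** — so this file generalises the CornerPin reductions
(p150634, p150961): for an interior mass-scaling regularisation with asymptotic scaling (read off any `IsQCDAlong` tuple), an eventual
intrinsic corner `mc` and `(m_crit − mc)·Z_m/a → μ₀`, the offset `ν₀ := −μ₀` is a ray-soft point (ray property by `RayDescent`,
softness by `ChiralCornerSoftness`, both applied to `reg` re-zeroed at `ν₀`). [folklore] -/
theorem raySoftPoint_of_cornerPin (h16900 : Theses.EulerDescent.RayDescent)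
    (h16902 : Theses.EulerDescent.ChiralCornerSoftness) (hNf : Nf = 2 ∨ Nf = 3) (reg : QCDRegularisation Nf)
    (hMS : reg.HasMassScaling) (hint : ∃ c : ℝ, -1 < c ∧ ∀ᶠ k in atTop, c ≤ reg.mcrit k)
    (hAS : (reg.scheme 0 0 0).HasAsymptoticScaling) {mc : ℕ → ℝ} {μ₀ : ℝ}
    (hcorner : ∀ᶠ k in atTop, IsLUB {ν : ℝ | ¬ (∀ (R R' : ℕ) (A : QCDLatticeObservable Nf R)
      (B : QCDLatticeObservable Nf R'), ∃ (C δ : ℝ) (S₀ : ℕ), 0 < δ ∧ ∀ S : ℕ, S₀ ≤ S → ∀ n : ℕ, n ≤ S →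
        ‖qcdLatticeConnectedCorr (reg.β k) (2 * S + 1) (fun _ : Fin Nf => ν) A B n‖ ≤ C * Real.exp (-(δ * n)))}
      (mc k))
    (hpin : Tendsto (fun k => (reg.mcrit k - mc k) * reg.Zm k / reg.a k) atTop (𝓝 μ₀)) :
    (∀ m : Fin Nf → ℝ, (∀ f, 0 < m f) → ∀ l : ℝ, 1 ≤ l → ∀ Δ : ℝ, 0 < Δ →
      (reg.scheme (fun f => -μ₀ + l * m f) 0 0).HasLatticeMassGap Δ → ∀ Δ' : ℝ, 0 < Δ' → Δ' < Δ / l →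
        (reg.scheme (fun f => -μ₀ + m f) 0 0).HasLatticeMassGap Δ') ∧
    (∀ ε > (0 : ℝ), ∃ m : Fin Nf → ℝ, (∀ f, 0 < m f) ∧ ¬ (reg.scheme (fun f => -μ₀ + m f) 0 0).HasLatticeMassGap ε) := by
  have hNf16 : Nf ≤ 16 := by rcases hNf with rfl | rfl <;> norm_num
  set reg₀ : QCDRegularisation Nf := { reg with mcrit := fun k => reg.mcrit k + reg.a k * (-μ₀) / reg.Zm k } with hreg₀
  have hs : ∀ (m : Fin Nf → ℝ) (z shift : QCDField Nf → ℕ → ℝ),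
      reg₀.scheme m z shift = reg.scheme (fun f => -μ₀ + m f) z shift :=
    fun m z shift => offsetShift_scheme_eq reg (-μ₀) m z shift
  have hMS₀ : reg₀.HasMassScaling := hMS
  have hAS₀ : (reg₀.scheme 0 0 0).HasAsymptoticScaling := hAS
  have hcorner₀ : ∀ᶠ k in atTop, IsLUB {ν : ℝ | ¬ (∀ (R R' : ℕ) (A : QCDLatticeObservable Nf R)
      (B : QCDLatticeObservable Nf R'), ∃ (C δ : ℝ) (S₀ : ℕ), 0 < δ ∧ ∀ S : ℕ, S₀ ≤ S → ∀ n : ℕ, n ≤ S →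
        ‖qcdLatticeConnectedCorr (reg₀.β k) (2 * S + 1) (fun _ : Fin Nf => ν) A B n‖ ≤ C * Real.exp (-(δ * n)))}
      (mc k) := hcorner
  have hpin₀ : Tendsto (fun k => (reg₀.mcrit k - mc k) * reg₀.Zm k / reg₀.a k) atTop (𝓝 0) := by
    have h1 : Tendsto (fun k => (reg.mcrit k - mc k) * reg.Zm k / reg.a k - μ₀) atTop (𝓝 (μ₀ - μ₀)) :=
      hpin.sub_const μ₀
    rw [sub_self] at h1
    refine h1.congr' (Eventually.of_forall fun k => ?_)
    have ha : reg.a k ≠ 0 := (reg.a_pos k).ne'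
    have hZ : reg.Zm k ≠ 0 := (reg.Zm_pos k).ne'
    change (reg.mcrit k - mc k) * reg.Zm k / reg.a k - μ₀ =
      ((reg.mcrit k + reg.a k * (-μ₀) / reg.Zm k) - mc k) * reg.Zm k / reg.a k
    field_simp
    ring
  have hbranch₀ : ∀ᶠ k in atTop, (-1 : ℝ) < reg₀.mcrit k := by
    obtain ⟨c, hc, hev⟩ := hint
    have h0 := tendsto_massIncrement_zero hNf16 reg hMS (-μ₀)
    have hneg : -((c + 1) / 2) < (0 : ℝ) := by linarith
    filter_upwards [hev, (tendsto_order.mp h0).1 (-((c + 1) / 2)) hneg] with k hk hk'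
    change (-1 : ℝ) < reg.mcrit k + reg.a k * (-μ₀) / reg.Zm k
    linarith
  have hray := h16900 Nf reg₀ mc hcorner₀ hpin₀ hMS₀ hAS₀ hbranch₀
  have hsoft : reg₀.IsChiralAtZero := h16902 Nf hNf reg₀ mc hcorner₀ hpin₀ hMS₀ hAS₀ hbranch₀
  refine ⟨fun m hm l hl Δ hΔ hg Δ' hΔ' hlt => ?_, fun ε hε => ?_⟩
  · have hg₀ : (reg₀.scheme (fun f => l * m f) 0 0).HasLatticeMassGap Δ := by rw [hs]; exact hg
    have := hray m hm l hl Δ hΔ hg₀ Δ' hΔ' hlt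
    rw [hs] at this
    exact this
  · obtain ⟨m, hm, hno⟩ := hsoft ε hε
    exact ⟨m, hm, by rw [← hs]; exact hno⟩

end Summit.QuantumFields.QCD.Cruxes.ChiralDescent.GapUpsetRecut
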